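import Summits.CriticalPhenomena.PercolationContinuityZ3.Theorems.PercNearOneGluingNoHeavyLowerTailThreePointProductFormFibreParallelCounts
import HarnessLib

/-!
# Parallel composition at the three terminals, IV: Boolean masks and families of pieces (Sahi programme, prover prim-sahi-p2 gen 59)

Support file (`--supports stmt-CriticalPhenomena-4575`, helper); continues `…ThreePointProductFormFibreParallelCounts` (same gen).
Standard axioms, no sorries, no named facts, no definitions.  Memo `run/shared/lean/prim/prim-sahi/FROM-prim-sahi-p2-gen59-ONE-STEP-LEMMA.md` §3, §8(2).

The six fibre statistics of a piece (`S0`, `isoC = S0∪P1`, `isoS = S0∪P2`, `Ga`, `Gb`, `G1`, cf. part III) are written here with a Boolean MASK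
`m : α → Bool` for the piece's labels (`x = fun l => z l && m l`, restricted flat `fun l => clusterFlip ends a x̄ l && m l`), which makes unions
literal (`m₁ || m₂`).  `card_parallel_*_mask`: the binary product law of part III in mask form.  `card_*_mask_false`: the empty piece has all six
statistics equal to `2^{#α}`.  The n-ary law for families of pieces is in parts V–VI (`…ParallelFamily`, `…ParallelFamilyFlat`).
[this work] (gen 59).
-/

namespace Summit.CriticalPhenomena.PercolationContinuityZ3.Theorems.ProductFormFibre

open Finset Literature.Probability.Percolation
open Summit.CriticalPhenomena.PercolationContinuityZ3.Theorems.ThreePointCPIClusterSwap (clusterFlip)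

variable {V α : Type*}

section Mask

variable [Fintype α] [DecidableEq α] [DecidableEq V] (ends : α → Sym2 V) (s a c : V)


open Classical in
/-- Mask form of `card_parallel_S0`. [this work] -/
theorem card_parallel_S0_mask
    (m₁ m₂ : α → Bool) (P₁ P₂ : V → Prop)
    (hQP₁ : ∀ l, m₁ l = true → ∀ v ∈ ends l, P₁ v ∨ (v = s ∨ v = a ∨ v = c))
    (hQP₂ : ∀ l, m₂ l = true → ∀ v ∈ ends l, P₂ v ∨ (v = s ∨ v = a ∨ v = c))
    (hPT₁ : ∀ v, P₁ v → ¬ (v = s ∨ v = a ∨ v = c)) (hPT₂ : ∀ v, P₂ v → ¬ (v = s ∨ v = a ∨ v = c))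
    (hP : ∀ v, P₁ v → ¬ P₂ v) (hQ : ∀ l, m₁ l = true → ¬ m₂ l = true) :
    (univ.filter fun z : α → Bool =>
        ((¬ (openGraph (labelledOpen ends (fun y => z y && (m₁ y || m₂ y)))).Reachable s a ∧
        ¬ (openGraph (labelledOpen ends (fun y => z y && (m₁ y || m₂ y)))).Reachable s c) ∧
        (¬ (openGraph (labelledOpen ends (fun y => z y && (m₁ y || m₂ y)))).Reachable c a ∧
        ¬ (openGraph (labelledOpen ends (fun y => z y && (m₁ y || m₂ y)))).Reachable c s))).card *
      (univ : Finset (α → Bool)).card =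
    (univ.filter fun z : α → Bool =>
        ((¬ (openGraph (labelledOpen ends (fun y => z y && m₁ y))).Reachable s a ∧
        ¬ (openGraph (labelledOpen ends (fun y => z y && m₁ y))).Reachable s c) ∧
        (¬ (openGraph (labelledOpen ends (fun y => z y && m₁ y))).Reachable c a ∧
        ¬ (openGraph (labelledOpen ends (fun y => z y && m₁ y))).Reachable c s))).card *
    (univ.filter fun z : α → Bool =>
        ((¬ (openGraph (labelledOpen ends (fun y => z y && m₂ y))).Reachable s a ∧
        ¬ (openGraph (labelledOpen ends (fun y => z y && m₂ y))).Reachable s c) ∧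
        (¬ (openGraph (labelledOpen ends (fun y => z y && m₂ y))).Reachable c a ∧
        ¬ (openGraph (labelledOpen ends (fun y => z y && m₂ y))).Reachable c s))).card := by
  have h := card_parallel_S0 ends s a c P₁ P₂ (fun l => m₁ l = true) (fun l => m₂ l = true) hQP₁ hQP₂ hPT₁ hPT₂ hP hQ
  simpa only [Bool.decide_or, Bool.decide_eq_true] using h


open Classical in
/-- Mask form of `card_parallel_isoC`. [this work] -/
theorem card_parallel_isoC_mask
    (m₁ m₂ : α → Bool) (P₁ P₂ : V → Prop)
    (hQP₁ : ∀ l, m₁ l = true → ∀ v ∈ ends l, P₁ v ∨ (v = s ∨ v = a ∨ v = c))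
    (hQP₂ : ∀ l, m₂ l = true → ∀ v ∈ ends l, P₂ v ∨ (v = s ∨ v = a ∨ v = c))
    (hPT₁ : ∀ v, P₁ v → ¬ (v = s ∨ v = a ∨ v = c)) (hPT₂ : ∀ v, P₂ v → ¬ (v = s ∨ v = a ∨ v = c))
    (hP : ∀ v, P₁ v → ¬ P₂ v) (hQ : ∀ l, m₁ l = true → ¬ m₂ l = true) :
    (univ.filter fun z : α → Bool =>
        (¬ (openGraph (labelledOpen ends (fun y => z y && (m₁ y || m₂ y)))).Reachable c a ∧
        ¬ (openGraph (labelledOpen ends (fun y => z y && (m₁ y || m₂ y)))).Reachable c s)).card *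
      (univ : Finset (α → Bool)).card =
    (univ.filter fun z : α → Bool =>
        (¬ (openGraph (labelledOpen ends (fun y => z y && m₁ y))).Reachable c a ∧
        ¬ (openGraph (labelledOpen ends (fun y => z y && m₁ y))).Reachable c s)).card *
    (univ.filter fun z : α → Bool =>
        (¬ (openGraph (labelledOpen ends (fun y => z y && m₂ y))).Reachable c a ∧
        ¬ (openGraph (labelledOpen ends (fun y => z y && m₂ y))).Reachable c s)).card := by
  have h := card_parallel_isoC ends s a c P₁ P₂ (fun l => m₁ l = true) (fun l => m₂ l = true) hQP₁ hQP₂ hPT₁ hPT₂ hP hQ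
  simpa only [Bool.decide_or, Bool.decide_eq_true] using h


open Classical in
/-- Mask form of `card_parallel_isoS`. [this work] -/
theorem card_parallel_isoS_mask
    (m₁ m₂ : α → Bool) (P₁ P₂ : V → Prop)
    (hQP₁ : ∀ l, m₁ l = true → ∀ v ∈ ends l, P₁ v ∨ (v = s ∨ v = a ∨ v = c))
    (hQP₂ : ∀ l, m₂ l = true → ∀ v ∈ ends l, P₂ v ∨ (v = s ∨ v = a ∨ v = c))
    (hPT₁ : ∀ v, P₁ v → ¬ (v = s ∨ v = a ∨ v = c)) (hPT₂ : ∀ v, P₂ v → ¬ (v = s ∨ v = a ∨ v = c))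
    (hP : ∀ v, P₁ v → ¬ P₂ v) (hQ : ∀ l, m₁ l = true → ¬ m₂ l = true) :
    (univ.filter fun z : α → Bool =>
        (¬ (openGraph (labelledOpen ends (fun y => z y && (m₁ y || m₂ y)))).Reachable s a ∧
        ¬ (openGraph (labelledOpen ends (fun y => z y && (m₁ y || m₂ y)))).Reachable s c)).card *
      (univ : Finset (α → Bool)).card =
    (univ.filter fun z : α → Bool =>
        (¬ (openGraph (labelledOpen ends (fun y => z y && m₁ y))).Reachable s a ∧
        ¬ (openGraph (labelledOpen ends (fun y => z y && m₁ y))).Reachable s c)).card *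
    (univ.filter fun z : α → Bool =>
        (¬ (openGraph (labelledOpen ends (fun y => z y && m₂ y))).Reachable s a ∧
        ¬ (openGraph (labelledOpen ends (fun y => z y && m₂ y))).Reachable s c)).card := by
  have h := card_parallel_isoS ends s a c P₁ P₂ (fun l => m₁ l = true) (fun l => m₂ l = true) hQP₁ hQP₂ hPT₁ hPT₂ hP hQ
  simpa only [Bool.decide_or, Bool.decide_eq_true] using h


open Classical in
/-- Mask form of `card_parallel_Ga`. [this work] -/
theorem card_parallel_Ga_mask
    (m₁ m₂ : α → Bool) (P₁ P₂ : V → Prop)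
    (hQP₁ : ∀ l, m₁ l = true → ∀ v ∈ ends l, P₁ v ∨ (v = s ∨ v = a ∨ v = c))
    (hQP₂ : ∀ l, m₂ l = true → ∀ v ∈ ends l, P₂ v ∨ (v = s ∨ v = a ∨ v = c))
    (hPT₁ : ∀ v, P₁ v → ¬ (v = s ∨ v = a ∨ v = c)) (hPT₂ : ∀ v, P₂ v → ¬ (v = s ∨ v = a ∨ v = c))
    (hP : ∀ v, P₁ v → ¬ P₂ v) (hQ : ∀ l, m₁ l = true → ¬ m₂ l = true) :
    (univ.filter fun z : α → Bool =>
        (((¬ (openGraph (labelledOpen ends (fun y => z y && (m₁ y || m₂ y)))).Reachable s a ∧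
        ¬ (openGraph (labelledOpen ends (fun y => z y && (m₁ y || m₂ y)))).Reachable s c) ∧
        (¬ (openGraph (labelledOpen ends (fun y => z y && (m₁ y || m₂ y)))).Reachable c a ∧
        ¬ (openGraph (labelledOpen ends (fun y => z y && (m₁ y || m₂ y)))).Reachable c s)) ∧
        (¬ (openGraph (labelledOpen ends (fun l =>
          clusterFlip ends a (fun y => !(z y && (m₁ y || m₂ y))) l && (m₁ l || m₂ l)))).Reachable c a ∧
        ¬ (openGraph (labelledOpen ends (fun l =>
          clusterFlip ends a (fun y => !(z y && (m₁ y || m₂ y))) l && (m₁ l || m₂ l)))).Reachable c s))).card *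
      (univ : Finset (α → Bool)).card =
    (univ.filter fun z : α → Bool =>
        (((¬ (openGraph (labelledOpen ends (fun y => z y && m₁ y))).Reachable s a ∧
        ¬ (openGraph (labelledOpen ends (fun y => z y && m₁ y))).Reachable s c) ∧
        (¬ (openGraph (labelledOpen ends (fun y => z y && m₁ y))).Reachable c a ∧
        ¬ (openGraph (labelledOpen ends (fun y => z y && m₁ y))).Reachable c s)) ∧
        (¬ (openGraph (labelledOpen ends (fun l =>
          clusterFlip ends a (fun y => !(z y && m₁ y)) l && m₁ l))).Reachable c a ∧
        ¬ (openGraph (labelledOpen ends (fun l =>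
          clusterFlip ends a (fun y => !(z y && m₁ y)) l && m₁ l))).Reachable c s))).card *
    (univ.filter fun z : α → Bool =>
        (((¬ (openGraph (labelledOpen ends (fun y => z y && m₂ y))).Reachable s a ∧
        ¬ (openGraph (labelledOpen ends (fun y => z y && m₂ y))).Reachable s c) ∧
        (¬ (openGraph (labelledOpen ends (fun y => z y && m₂ y))).Reachable c a ∧
        ¬ (openGraph (labelledOpen ends (fun y => z y && m₂ y))).Reachable c s)) ∧
        (¬ (openGraph (labelledOpen ends (fun l =>
          clusterFlip ends a (fun y => !(z y && m₂ y)) l && m₂ l))).Reachable c a ∧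
        ¬ (openGraph (labelledOpen ends (fun l =>
          clusterFlip ends a (fun y => !(z y && m₂ y)) l && m₂ l))).Reachable c s))).card := by
  have h := card_parallel_Ga ends s a c P₁ P₂ (fun l => m₁ l = true) (fun l => m₂ l = true) hQP₁ hQP₂ hPT₁ hPT₂ hP hQ
  simpa only [Bool.decide_or, Bool.decide_eq_true] using h


open Classical in
/-- Mask form of `card_parallel_Gb`. [this work] -/
theorem card_parallel_Gb_mask
    (m₁ m₂ : α → Bool) (P₁ P₂ : V → Prop)
    (hQP₁ : ∀ l, m₁ l = true → ∀ v ∈ ends l, P₁ v ∨ (v = s ∨ v = a ∨ v = c))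
    (hQP₂ : ∀ l, m₂ l = true → ∀ v ∈ ends l, P₂ v ∨ (v = s ∨ v = a ∨ v = c))
    (hPT₁ : ∀ v, P₁ v → ¬ (v = s ∨ v = a ∨ v = c)) (hPT₂ : ∀ v, P₂ v → ¬ (v = s ∨ v = a ∨ v = c))
    (hP : ∀ v, P₁ v → ¬ P₂ v) (hQ : ∀ l, m₁ l = true → ¬ m₂ l = true) :
    (univ.filter fun z : α → Bool =>
        (((¬ (openGraph (labelledOpen ends (fun y => z y && (m₁ y || m₂ y)))).Reachable s a ∧
        ¬ (openGraph (labelledOpen ends (fun y => z y && (m₁ y || m₂ y)))).Reachable s c) ∧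
        (¬ (openGraph (labelledOpen ends (fun y => z y && (m₁ y || m₂ y)))).Reachable c a ∧
        ¬ (openGraph (labelledOpen ends (fun y => z y && (m₁ y || m₂ y)))).Reachable c s)) ∧
        (¬ (openGraph (labelledOpen ends (fun l =>
          clusterFlip ends a (fun y => !(z y && (m₁ y || m₂ y))) l && (m₁ l || m₂ l)))).Reachable s a ∧
        ¬ (openGraph (labelledOpen ends (fun l =>
          clusterFlip ends a (fun y => !(z y && (m₁ y || m₂ y))) l && (m₁ l || m₂ l)))).Reachable s c))).card *
      (univ : Finset (α → Bool)).card =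
    (univ.filter fun z : α → Bool =>
        (((¬ (openGraph (labelledOpen ends (fun y => z y && m₁ y))).Reachable s a ∧
        ¬ (openGraph (labelledOpen ends (fun y => z y && m₁ y))).Reachable s c) ∧
        (¬ (openGraph (labelledOpen ends (fun y => z y && m₁ y))).Reachable c a ∧
        ¬ (openGraph (labelledOpen ends (fun y => z y && m₁ y))).Reachable c s)) ∧
        (¬ (openGraph (labelledOpen ends (fun l =>
          clusterFlip ends a (fun y => !(z y && m₁ y)) l && m₁ l))).Reachable s a ∧
        ¬ (openGraph (labelledOpen ends (fun l =>
          clusterFlip ends a (fun y => !(z y && m₁ y)) l && m₁ l))).Reachable s c))).card *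
    (univ.filter fun z : α → Bool =>
        (((¬ (openGraph (labelledOpen ends (fun y => z y && m₂ y))).Reachable s a ∧
        ¬ (openGraph (labelledOpen ends (fun y => z y && m₂ y))).Reachable s c) ∧
        (¬ (openGraph (labelledOpen ends (fun y => z y && m₂ y))).Reachable c a ∧
        ¬ (openGraph (labelledOpen ends (fun y => z y && m₂ y))).Reachable c s)) ∧
        (¬ (openGraph (labelledOpen ends (fun l =>
          clusterFlip ends a (fun y => !(z y && m₂ y)) l && m₂ l))).Reachable s a ∧
        ¬ (openGraph (labelledOpen ends (fun l =>
          clusterFlip ends a (fun y => !(z y && m₂ y)) l && m₂ l))).Reachable s c))).card := by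
  have h := card_parallel_Gb ends s a c P₁ P₂ (fun l => m₁ l = true) (fun l => m₂ l = true) hQP₁ hQP₂ hPT₁ hPT₂ hP hQ
  simpa only [Bool.decide_or, Bool.decide_eq_true] using h


open Classical in
/-- Mask form of `card_parallel_G1`. [this work] -/
theorem card_parallel_G1_mask
    (m₁ m₂ : α → Bool) (P₁ P₂ : V → Prop)
    (hQP₁ : ∀ l, m₁ l = true → ∀ v ∈ ends l, P₁ v ∨ (v = s ∨ v = a ∨ v = c))
    (hQP₂ : ∀ l, m₂ l = true → ∀ v ∈ ends l, P₂ v ∨ (v = s ∨ v = a ∨ v = c))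
    (hPT₁ : ∀ v, P₁ v → ¬ (v = s ∨ v = a ∨ v = c)) (hPT₂ : ∀ v, P₂ v → ¬ (v = s ∨ v = a ∨ v = c))
    (hP : ∀ v, P₁ v → ¬ P₂ v) (hQ : ∀ l, m₁ l = true → ¬ m₂ l = true) :
    (univ.filter fun z : α → Bool =>
        (((¬ (openGraph (labelledOpen ends (fun y => z y && (m₁ y || m₂ y)))).Reachable s a ∧
        ¬ (openGraph (labelledOpen ends (fun y => z y && (m₁ y || m₂ y)))).Reachable s c) ∧
        (¬ (openGraph (labelledOpen ends (fun y => z y && (m₁ y || m₂ y)))).Reachable c a ∧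
        ¬ (openGraph (labelledOpen ends (fun y => z y && (m₁ y || m₂ y)))).Reachable c s)) ∧
        ((¬ (openGraph (labelledOpen ends (fun l =>
          clusterFlip ends a (fun y => !(z y && (m₁ y || m₂ y))) l && (m₁ l || m₂ l)))).Reachable s a ∧
        ¬ (openGraph (labelledOpen ends (fun l =>
          clusterFlip ends a (fun y => !(z y && (m₁ y || m₂ y))) l && (m₁ l || m₂ l)))).Reachable s c) ∧
        (¬ (openGraph (labelledOpen ends (fun l =>
          clusterFlip ends a (fun y => !(z y && (m₁ y || m₂ y))) l && (m₁ l || m₂ l)))).Reachable c a ∧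
        ¬ (openGraph (labelledOpen ends (fun l =>
          clusterFlip ends a (fun y => !(z y && (m₁ y || m₂ y))) l && (m₁ l || m₂ l)))).Reachable c s)))).card *
      (univ : Finset (α → Bool)).card =
    (univ.filter fun z : α → Bool =>
        (((¬ (openGraph (labelledOpen ends (fun y => z y && m₁ y))).Reachable s a ∧
        ¬ (openGraph (labelledOpen ends (fun y => z y && m₁ y))).Reachable s c) ∧
        (¬ (openGraph (labelledOpen ends (fun y => z y && m₁ y))).Reachable c a ∧
        ¬ (openGraph (labelledOpen ends (fun y => z y && m₁ y))).Reachable c s)) ∧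
        ((¬ (openGraph (labelledOpen ends (fun l =>
          clusterFlip ends a (fun y => !(z y && m₁ y)) l && m₁ l))).Reachable s a ∧
        ¬ (openGraph (labelledOpen ends (fun l =>
          clusterFlip ends a (fun y => !(z y && m₁ y)) l && m₁ l))).Reachable s c) ∧
        (¬ (openGraph (labelledOpen ends (fun l =>
          clusterFlip ends a (fun y => !(z y && m₁ y)) l && m₁ l))).Reachable c a ∧
        ¬ (openGraph (labelledOpen ends (fun l =>
          clusterFlip ends a (fun y => !(z y && m₁ y)) l && m₁ l))).Reachable c s)))).card *
    (univ.filter fun z : α → Bool =>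
        (((¬ (openGraph (labelledOpen ends (fun y => z y && m₂ y))).Reachable s a ∧
        ¬ (openGraph (labelledOpen ends (fun y => z y && m₂ y))).Reachable s c) ∧
        (¬ (openGraph (labelledOpen ends (fun y => z y && m₂ y))).Reachable c a ∧
        ¬ (openGraph (labelledOpen ends (fun y => z y && m₂ y))).Reachable c s)) ∧
        ((¬ (openGraph (labelledOpen ends (fun l =>
          clusterFlip ends a (fun y => !(z y && m₂ y)) l && m₂ l))).Reachable s a ∧
        ¬ (openGraph (labelledOpen ends (fun l =>
          clusterFlip ends a (fun y => !(z y && m₂ y)) l && m₂ l))).Reachable s c) ∧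
        (¬ (openGraph (labelledOpen ends (fun l =>
          clusterFlip ends a (fun y => !(z y && m₂ y)) l && m₂ l))).Reachable c a ∧
        ¬ (openGraph (labelledOpen ends (fun l =>
          clusterFlip ends a (fun y => !(z y && m₂ y)) l && m₂ l))).Reachable c s)))).card := by
  have h := card_parallel_G1 ends s a c P₁ P₂ (fun l => m₁ l = true) (fun l => m₂ l = true) hQP₁ hQP₂ hPT₁ hPT₂ hP hQ
  simpa only [Bool.decide_or, Bool.decide_eq_true] using h


open Classical in
omit [DecidableEq V] in
/-- The empty piece: `S0` holds for every configuration. [this work] -/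
theorem card_S0_mask_false (hsa : s ≠ a) (hca : c ≠ a) (hsc : s ≠ c) :
    (univ.filter fun z : α → Bool =>
        ((¬ (openGraph (labelledOpen ends (fun y => z y && false))).Reachable s a ∧
        ¬ (openGraph (labelledOpen ends (fun y => z y && false))).Reachable s c) ∧
        (¬ (openGraph (labelledOpen ends (fun y => z y && false))).Reachable c a ∧
        ¬ (openGraph (labelledOpen ends (fun y => z y && false))).Reachable c s))).card =
      (univ : Finset (α → Bool)).card := by
  refine congrArg Finset.card (Finset.filter_true_of_mem fun z _ => ?_)
  have hbot : ∀ (w : α → Bool), (∀ l, w l = false) → ∀ p q : V, ((openGraph (labelledOpen ends w)).Reachable p q ↔ p = q) := by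
    intro w hw p q
    have : openGraph (labelledOpen ends w) = ⊥ := by
      ext x y
      simp only [openGraph_adj, labelledOpen, Set.mem_setOf_eq, hw, SimpleGraph.bot_adj, iff_false, not_and]
      rintro ⟨l, hl, -⟩; exact absurd hl Bool.false_ne_true
    rw [this]; exact SimpleGraph.reachable_bot
  have h1 := hbot (fun y => z y && false) (fun l => by simp)
  simp only [h1]
  exact ⟨⟨hsa, hsc⟩, ⟨hca, fun h => hsc h.symm⟩⟩


open Classical in
omit [DecidableEq V] in
/-- The empty piece: `isoC` holds for every configuration. [this work] -/
theorem card_isoC_mask_false (hca : c ≠ a) (hsc : s ≠ c) :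
    (univ.filter fun z : α → Bool =>
        (¬ (openGraph (labelledOpen ends (fun y => z y && false))).Reachable c a ∧
        ¬ (openGraph (labelledOpen ends (fun y => z y && false))).Reachable c s)).card =
      (univ : Finset (α → Bool)).card := by
  refine congrArg Finset.card (Finset.filter_true_of_mem fun z _ => ?_)
  have hbot : ∀ (w : α → Bool), (∀ l, w l = false) → ∀ p q : V, ((openGraph (labelledOpen ends w)).Reachable p q ↔ p = q) := by
    intro w hw p q
    have : openGraph (labelledOpen ends w) = ⊥ := by
      ext x y
      simp only [openGraph_adj, labelledOpen, Set.mem_setOf_eq, hw, SimpleGraph.bot_adj, iff_false, not_and]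
      rintro ⟨l, hl, -⟩; exact absurd hl Bool.false_ne_true
    rw [this]; exact SimpleGraph.reachable_bot
  have h1 := hbot (fun y => z y && false) (fun l => by simp)
  simp only [h1]
  exact ⟨hca, fun h => hsc h.symm⟩


open Classical in
omit [DecidableEq V] in
/-- The empty piece: `isoS` holds for every configuration. [this work] -/
theorem card_isoS_mask_false (hsa : s ≠ a) (hsc : s ≠ c) :
    (univ.filter fun z : α → Bool =>
        (¬ (openGraph (labelledOpen ends (fun y => z y && false))).Reachable s a ∧
        ¬ (openGraph (labelledOpen ends (fun y => z y && false))).Reachable s c)).card =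
      (univ : Finset (α → Bool)).card := by
  refine congrArg Finset.card (Finset.filter_true_of_mem fun z _ => ?_)
  have hbot : ∀ (w : α → Bool), (∀ l, w l = false) → ∀ p q : V, ((openGraph (labelledOpen ends w)).Reachable p q ↔ p = q) := by
    intro w hw p q
    have : openGraph (labelledOpen ends w) = ⊥ := by
      ext x y
      simp only [openGraph_adj, labelledOpen, Set.mem_setOf_eq, hw, SimpleGraph.bot_adj, iff_false, not_and]
      rintro ⟨l, hl, -⟩; exact absurd hl Bool.false_ne_true
    rw [this]; exact SimpleGraph.reachable_bot
  have h1 := hbot (fun y => z y && false) (fun l => by simp)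
  simp only [h1]
  exact ⟨hsa, hsc⟩


open Classical in
omit [DecidableEq V] in
/-- The empty piece: `Ga` holds for every configuration. [this work] -/
theorem card_Ga_mask_false (hsa : s ≠ a) (hca : c ≠ a) (hsc : s ≠ c) :
    (univ.filter fun z : α → Bool =>
        (((¬ (openGraph (labelledOpen ends (fun y => z y && false))).Reachable s a ∧
        ¬ (openGraph (labelledOpen ends (fun y => z y && false))).Reachable s c) ∧
        (¬ (openGraph (labelledOpen ends (fun y => z y && false))).Reachable c a ∧
        ¬ (openGraph (labelledOpen ends (fun y => z y && false))).Reachable c s)) ∧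
        (¬ (openGraph (labelledOpen ends (fun l =>
          clusterFlip ends a (fun y => !(z y && false)) l && false))).Reachable c a ∧
        ¬ (openGraph (labelledOpen ends (fun l =>
          clusterFlip ends a (fun y => !(z y && false)) l && false))).Reachable c s))).card =
      (univ : Finset (α → Bool)).card := by
  refine congrArg Finset.card (Finset.filter_true_of_mem fun z _ => ?_)
  have hbot : ∀ (w : α → Bool), (∀ l, w l = false) → ∀ p q : V, ((openGraph (labelledOpen ends w)).Reachable p q ↔ p = q) := by
    intro w hw p q
    have : openGraph (labelledOpen ends w) = ⊥ := by
      ext x y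
      simp only [openGraph_adj, labelledOpen, Set.mem_setOf_eq, hw, SimpleGraph.bot_adj, iff_false, not_and]
      rintro ⟨l, hl, -⟩; exact absurd hl Bool.false_ne_true
    rw [this]; exact SimpleGraph.reachable_bot
  have h1 := hbot (fun y => z y && false) (fun l => by simp)
  have h2 := hbot (fun l => clusterFlip ends a (fun y => !(z y && false)) l && false) (fun l => by simp)
  simp only [h1, h2]
  exact ⟨⟨⟨hsa, hsc⟩, ⟨hca, fun h => hsc h.symm⟩⟩, ⟨hca, fun h => hsc h.symm⟩⟩


open Classical in
omit [DecidableEq V] in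
/-- The empty piece: `Gb` holds for every configuration. [this work] -/
theorem card_Gb_mask_false (hsa : s ≠ a) (hca : c ≠ a) (hsc : s ≠ c) :
    (univ.filter fun z : α → Bool =>
        (((¬ (openGraph (labelledOpen ends (fun y => z y && false))).Reachable s a ∧
        ¬ (openGraph (labelledOpen ends (fun y => z y && false))).Reachable s c) ∧
        (¬ (openGraph (labelledOpen ends (fun y => z y && false))).Reachable c a ∧
        ¬ (openGraph (labelledOpen ends (fun y => z y && false))).Reachable c s)) ∧
        (¬ (openGraph (labelledOpen ends (fun l =>
          clusterFlip ends a (fun y => !(z y && false)) l && false))).Reachable s a ∧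
        ¬ (openGraph (labelledOpen ends (fun l =>
          clusterFlip ends a (fun y => !(z y && false)) l && false))).Reachable s c))).card =
      (univ : Finset (α → Bool)).card := by
  refine congrArg Finset.card (Finset.filter_true_of_mem fun z _ => ?_)
  have hbot : ∀ (w : α → Bool), (∀ l, w l = false) → ∀ p q : V, ((openGraph (labelledOpen ends w)).Reachable p q ↔ p = q) := by
    intro w hw p q
    have : openGraph (labelledOpen ends w) = ⊥ := by
      ext x y
      simp only [openGraph_adj, labelledOpen, Set.mem_setOf_eq, hw, SimpleGraph.bot_adj, iff_false, not_and]
      rintro ⟨l, hl, -⟩; exact absurd hl Bool.false_ne_true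
    rw [this]; exact SimpleGraph.reachable_bot
  have h1 := hbot (fun y => z y && false) (fun l => by simp)
  have h2 := hbot (fun l => clusterFlip ends a (fun y => !(z y && false)) l && false) (fun l => by simp)
  simp only [h1, h2]
  exact ⟨⟨⟨hsa, hsc⟩, ⟨hca, fun h => hsc h.symm⟩⟩, ⟨hsa, hsc⟩⟩


open Classical in
omit [DecidableEq V] in
/-- The empty piece: `G1` holds for every configuration. [this work] -/
theorem card_G1_mask_false (hsa : s ≠ a) (hca : c ≠ a) (hsc : s ≠ c) :
    (univ.filter fun z : α → Bool =>
        (((¬ (openGraph (labelledOpen ends (fun y => z y && false))).Reachable s a ∧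
        ¬ (openGraph (labelledOpen ends (fun y => z y && false))).Reachable s c) ∧
        (¬ (openGraph (labelledOpen ends (fun y => z y && false))).Reachable c a ∧
        ¬ (openGraph (labelledOpen ends (fun y => z y && false))).Reachable c s)) ∧
        ((¬ (openGraph (labelledOpen ends (fun l =>
          clusterFlip ends a (fun y => !(z y && false)) l && false))).Reachable s a ∧
        ¬ (openGraph (labelledOpen ends (fun l =>
          clusterFlip ends a (fun y => !(z y && false)) l && false))).Reachable s c) ∧
        (¬ (openGraph (labelledOpen ends (fun l =>
          clusterFlip ends a (fun y => !(z y && false)) l && false))).Reachable c a ∧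
        ¬ (openGraph (labelledOpen ends (fun l =>
          clusterFlip ends a (fun y => !(z y && false)) l && false))).Reachable c s)))).card =
      (univ : Finset (α → Bool)).card := by
  refine congrArg Finset.card (Finset.filter_true_of_mem fun z _ => ?_)
  have hbot : ∀ (w : α → Bool), (∀ l, w l = false) → ∀ p q : V, ((openGraph (labelledOpen ends w)).Reachable p q ↔ p = q) := by
    intro w hw p q
    have : openGraph (labelledOpen ends w) = ⊥ := by
      ext x y
      simp only [openGraph_adj, labelledOpen, Set.mem_setOf_eq, hw, SimpleGraph.bot_adj, iff_false, not_and]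
      rintro ⟨l, hl, -⟩; exact absurd hl Bool.false_ne_true
    rw [this]; exact SimpleGraph.reachable_bot
  have h1 := hbot (fun y => z y && false) (fun l => by simp)
  have h2 := hbot (fun l => clusterFlip ends a (fun y => !(z y && false)) l && false) (fun l => by simp)
  simp only [h1, h2]
  exact ⟨⟨⟨hsa, hsc⟩, ⟨hca, fun h => hsc h.symm⟩⟩, ⟨⟨hsa, hsc⟩, ⟨hca, fun h => hsc h.symm⟩⟩⟩


end Mask

end Summit.CriticalPhenomena.PercolationContinuityZ3.Theorems.ProductFormFibre
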